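import Summits.QuantumFields.YangMills.Theorems.BalabanUVNodesN08HaarCompatibilityGuardHybridForestPolymer
import Summits.QuantumFields.YangMills.Theorems.BalabanUVNodesN08HaarCompatibilityGuardHybridNearBlockSet

/-!
# BalabanUVNodes ∕ N08 — THE FOREST PRINCIPLE, ABSTRACTLY AND RELATIVE TO A BLOCK SET: a coarse-gauge-invariant finite law that is `[near marginal] ⊗ Haar^{Far}` for a far set
# whose complement is an ACYCLIC family of bonds is EXACTLY `mass • dV`; hence the transported guarded part `((ρ·1_{G_S})·dU)∘(Ū^S)⁻¹` is `mass • dV` whenever `ρ` is gauge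
# invariant, reads only the blocks of some `𝔅 ⊇ Blk(S)`, and the bonds with both end blocks in `𝔅` form a forest

WIDTH SEAT `pub-ymgap-dag-n08-w3` g7, item-3 lineage PART 41 (successor of parts 39 `…GuardHybridForestPolymer` (the case `𝔅 = Blk(S)`) and 37B `…GuardHybridNearBlockSet` (far set of a
block set)), 2026-08-28.  Track A, DAG node N08 = [Balaban1985UV3] Thm 1 p. 257 (compact) + Thm 2 p. 272; key item K1⁷ `StabilityBAtRecordR13SepCoPH` (stmt-QuantumFields-20542),
`--supports … --as helper`.  COUNT-NEUTRAL.

THE POINT (located; road (ii) bookkeeping, n08-w1 g6 `N08-NO-STACKING-MECHANISM.md` §3∕§5; count-neutral).  Part 39 proved «forest polymers are invisible» for densities reading only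
`Blk(S)`.  From the second RG step on, the input density of a polymer `S` is a bump `B_Y·1_{G_S}` reading a LARGER block set `𝔅 = Blk(S) ∪ supp(Y)` (parts 37B∕40).  This file isolates
the mechanism as an abstract principle (§1 `eq_mass_smul_of_invariant_of_prod_of_forest`): **a finite coarse-gauge-invariant law `ν` with `ν∘split_Far⁻¹ = ν₁ ⊗ Haar^{Far}` whose near
family `{c // ¬Far c}` is enumerated by an acyclic `b : Fin n → PBond` IS `ν(univ) • dV`** (g0 part 4 on the near family; reindexing; the splitting equivalence back), and instantiates
it at the block-set far set (§2 `map_withDensity_guard_hybrid_eq_smul_of_blockSet_forest`): for `ρ ≥ 0` gauge invariant, measurable, integrable, reading only the blocks of `𝔅 ⊇ Blk(S)`,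
and the bonds with both end blocks in `𝔅` an acyclic family, **`((ρ·1_{G_S})·dU)∘(Ū^S)⁻¹ = (∫ ρ·1_{G_S} dU) • dV`** — e.g. a guarded bond `c` dressed by a bump supported on blocks
forming, with `c₋, c₊`, a tree of the coarse lattice.  §3: the slot form (`avOfPrint N S₀ j` on `SU(N)`, every `N`, standing range).

HONEST FRAMING.  [folklore] measure theory over landed modules; nothing of Bałaban's asserted; EXACT identities for acyclic configurations only — no bound for cycles, NO cluster
expansion ∕ (G3), NO k-uniform `hmass`; E6′ NOT decided; N08 NOT discharged; counts unmoved (typed 28∕28 · discharged 5∕27); one finite 𝕋⁴ programme at fixed ε — R4 closes the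
CONDITIONAL rung `BalabanLadder.UV` only; the Yang–Mills mass gap (Clay) is NOT proved by any of this; nothing continuum ∕ ℝ⁴ ∕ OS.  0 `sorry`, 0 `def`, 0 `instance`, standard axioms.
-/

noncomputable section

open MeasureTheory
open scoped ENNReal

namespace Summit.QuantumFields.YangMills.BalabanUVNodes.N08HaarCompatibilityGuardHybridForestBlockSet

open Literature.MathematicalPhysics.QuantumFieldTheory.Balaban1983to89
open Literature.MathematicalPhysics.QuantumFieldTheory.Balaban1983to89.AveragingRT (axialAvg measurable_axialAvg line)
open Literature.MathematicalPhysics.QuantumFieldTheory.Balaban1983to89.BlockAveraging (Small avgFun measurable_avgFun)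
open Summit.QuantumFields.Balaban3D.Proofs
open Summit.QuantumFields.YangMills.BalabanUVNodes.N08HaarCompatibilityPrivateSources (measurable_evalFamily)
open Summit.QuantumFields.YangMills.BalabanUVNodes.N08HaarCompatibilityGuardHybridPartition (measurable_hybrid measurableSet_guardAll)
open Summit.QuantumFields.YangMills.BalabanUVNodes.N08HaarCompatibilityGuardHybridFresh (map_withDensity_hybrid_split_eq_prod)
open Summit.QuantumFields.YangMills.BalabanUVNodes.N08HaarCompatibilityGuardHybridNearBlocks (canonical_tau_lt not_canonicalFar_iff localOff_of_blockLocal guardAll_indicator_blockLocal)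
open Summit.QuantumFields.YangMills.BalabanUVNodes.N08HaarCompatibilityGuardHybridNearBlockSet (blockSet_far_spec)
open Summit.QuantumFields.YangMills.BalabanUVNodes.N08HaarCompatibilityGuardHybridCovariance
  (map_gaugeAct_withDensity_of_gaugeInvariant gaugeInvariant_mul_guardAll_indicator map_gaugeAct_map_hybrid)
open Summit.QuantumFields.YangMills.BalabanUVNodes.N08HaarCompatibilityGuardHybridForestPolymer (piCongrLeft_symm_apply' map_evalFamily_eq_mass_smul_pi_haar_of_leafOrder)

/-! ## §1 The abstract forest principle -/

section Principle

variable {P : Params} {k : ℕ} {G : Type} [GaugeGroup G] [MeasurableSpace G] [RegularGaugeGroup G] [HaarData G]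

/-- ★★★ **THE FOREST PRINCIPLE.**  A finite, coarse-gauge-invariant law `ν` on coarse fields whose image under the splitting along a far set `Far` is a product
`ν₁ ⊗ Haar^{Far}`, and whose near family `{c // ¬Far c}` is enumerated by an injective acyclic `b : Fin n → PBond` (leaf-extension order `side`, `hleaf`), is EXACTLY
`ν(univ) • dV`: the near marginal is a finite gauge-invariant law on a forest, hence `ν(univ) • Haar^{near}` (g0 part 4), and `Haar^{near} ⊗ Haar^{Far} = dV∘split⁻¹`.
[cite: Balaban1987RG1, (2.1) p.265 (bookkeeping); folklore] -/
theorem eq_mass_smul_of_invariant_of_prod_of_forest (Far : PBond P k → Prop) [DecidablePred Far] (ν : Measure (GaugeField P k G)) (hfin : IsFiniteMeasure ν)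
    (hν : ∀ v : GaugeTransf P k G, ν.map (GaugeField.gaugeAct v) = ν)
    (ν₁ : Measure ({c : PBond P k // ¬ Far c} → G))
    (hprod : ν.map (FibreSplit.splitEquiv Far (P := P) (G := G)) = ν₁.prod (Measure.pi fun _ : {c : PBond P k // ¬¬ Far c} => (HaarData.haar : Measure G)))
    {n : ℕ} (b : Fin n → PBond P k) (hbinj : Function.Injective b) (hbnear : ∀ m, ¬ Far (b m)) (hbonto : ∀ c, ¬ Far c → ∃ m, b m = c)
    (side : Fin n → Bool)
    (hleaf : ∀ m m' : Fin n, m' < m →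
      (if side m then (b m).src else (b m).tgt) ≠ (b m').src ∧ (if side m then (b m).src else (b m).tgt) ≠ (b m').tgt) :
    ν = ν Set.univ • fieldMeasure P k G := by
  haveI := HaarData.isProb (G := G)
  haveI := hfin
  -- g0 part 4 on `ν`: the near family `b` is `mass • Haar^n`
  have hforest := map_evalFamily_eq_mass_smul_pi_haar_of_leafOrder b side hleaf ν hfin hν
  -- the enumeration `e : Fin n ≃ near` and the reindexing `R w = w ∘ e`
  let e : Fin n ≃ {c : PBond P k // ¬ Far c} :=
    Equiv.ofBijective (fun m => ⟨b m, hbnear m⟩)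
      ⟨fun m m' h => hbinj (congrArg Subtype.val h), fun x => by
        obtain ⟨m, hm⟩ := hbonto x.1 x.2
        exact ⟨m, Subtype.ext hm⟩⟩
  set R := (MeasurableEquiv.piCongrLeft (fun _ : {c : PBond P k // ¬ Far c} => G) e).symm with hRdef
  have hR_apply : ∀ w, R w = fun m => w (e m) := fun w => piCongrLeft_symm_apply' e w
  have hRmp : MeasurePreserving R (Measure.pi fun _ => (HaarData.haar : Measure G)) (Measure.pi fun _ : Fin n => (HaarData.haar : Measure G)) :=
    (MeasureTheory.measurePreserving_piCongrLeft (fun _ : {c : PBond P k // ¬ Far c} => (HaarData.haar : Measure G)) e).symm _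
  -- the near marginal `ν₁` is `ν.map (V ↦ V↾near)`, and along `R` it is the law of the family `b`
  have hν₁ : ν₁ = ν.map (fun V : GaugeField P k G => (FibreSplit.splitEquiv Far (P := P) (G := G) V).1) := by
    have h1 : (ν.map (FibreSplit.splitEquiv Far (P := P) (G := G))).map Prod.fst = ν₁ := by
      rw [hprod]
      exact Measure.fst_prod
    rw [← h1, Measure.map_map measurable_fst (FibreSplit.splitEquiv Far (P := P) (G := G)).measurable]
    rfl
  have hnear : ν₁ = ν Set.univ • Measure.pi (fun _ : {c : PBond P k // ¬ Far c} => (HaarData.haar : Measure G)) := by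
    have hm : Measurable fun V : GaugeField P k G => (FibreSplit.splitEquiv Far (P := P) (G := G) V).1 :=
      measurable_fst.comp (FibreSplit.splitEquiv Far (P := P) (G := G)).measurable
    have h1 : ν₁.map R = ν.map (fun (V : GaugeField P k G) (m : Fin n) => V (b m)) := by
      rw [hν₁, Measure.map_map R.measurable hm]
      refine Measure.map_congr (Filter.Eventually.of_forall fun V => ?_)
      show R _ = _
      rw [hR_apply]
      rfl
    have h2 : (ν Set.univ • Measure.pi (fun _ : {c : PBond P k // ¬ Far c} => (HaarData.haar : Measure G))).map R =
        ν Set.univ • Measure.pi (fun _ : Fin n => (HaarData.haar : Measure G)) := by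
      rw [Measure.map_smul, hRmp.map_eq]
    calc ν₁ = (ν₁.map R).map R.symm := (MeasurableEquiv.map_symm_map R).symm
      _ = (ν Set.univ • Measure.pi (fun _ : Fin n => (HaarData.haar : Measure G))).map R.symm := by rw [h1, hforest]
      _ = ((ν Set.univ • Measure.pi (fun _ : {c : PBond P k // ¬ Far c} => (HaarData.haar : Measure G))).map R).map R.symm := by rw [h2]
      _ = _ := MeasurableEquiv.map_symm_map R
  -- assemble through the splitting equivalence
  have hsplit := (FibreSplit.measurePreserving_split Far (P := P) (j := k) (G := G)).map_eq
  calc ν = (ν.map (FibreSplit.splitEquiv Far (P := P) (G := G))).map (FibreSplit.splitEquiv Far (P := P) (G := G)).symm := (MeasurableEquiv.map_symm_map _).symm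
    _ = ((ν Set.univ • fieldMeasure P k G).map (FibreSplit.splitEquiv Far (P := P) (G := G))).map (FibreSplit.splitEquiv Far (P := P) (G := G)).symm := by
        rw [hprod, hnear, Measure.map_smul, hsplit, Measure.prod_smul_left]
    _ = _ := MeasurableEquiv.map_symm_map _

end Principle

/-! ## §2 Forest polymers relative to a block set `𝔅 ⊇ Blk(S)` -/

section BlockSet

variable {P : Params} {j : ℕ} {G : Type} [GaugeGroup G] (ℰ : LoopAverage G) [DecidableEq (PBond P (j + 1))] [MeasurableSpace G] [RegularGaugeGroup G] [HaarData G]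

/-- ★★★ **FOREST POLYMERS RELATIVE TO A BLOCK SET ARE INVISIBLE.**  Standing range, every measurable `ℰ`, a finset `S` of coarse bonds, a block set `𝔅 ⊇ Blk(S)` whose near family —
the bonds with BOTH end blocks in `𝔅` — is enumerated by an injective acyclic `b : Fin n → PBond`, and a gauge-invariant, non-negative, measurable, integrable density `ρ` reading
only the bonds issuing from the blocks of `𝔅`: **`((ρ·1_{G_S})·dU)∘(Ū^S)⁻¹ = (∫ ρ·1_{G_S} dU) • dV`** (§1 with part 35's product form at the far set of `𝔅` (part 37B) and part 38A's
invariance of the image). [cite: Balaban1987RG1, (2.1) p.265 + (0.4) p.253; Balaban1985UV3, (10) p.258 + (48)–(49) p.268; Balaban1985Averaging, (11)+(15) p.19 (bookkeeping — NOT in print)] -/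
theorem map_withDensity_guard_hybrid_eq_smul_of_blockSet_forest (hj : j + 1 ≤ P.m + P.K) (hE : ∀ n, Measurable fun W : Fin (n + 1) → G => ℰ.E W)
    (S : Finset (PBond P (j + 1))) (𝔅 : Finset (Site P (j + 1))) (hS : ∀ c ∈ S, c.src ∈ 𝔅 ∧ c.tgt ∈ 𝔅)
    {n : ℕ} (b : Fin n → PBond P (j + 1)) (hbinj : Function.Injective b) (hbnear : ∀ m, (b m).src ∈ 𝔅 ∧ (b m).tgt ∈ 𝔅)
    (hbonto : ∀ c' : PBond P (j + 1), c'.src ∈ 𝔅 ∧ c'.tgt ∈ 𝔅 → ∃ m, b m = c')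
    (side : Fin n → Bool)
    (hleaf : ∀ m m' : Fin n, m' < m →
      (if side m then (b m).src else (b m).tgt) ≠ (b m').src ∧ (if side m then (b m).src else (b m).tgt) ≠ (b m').tgt)
    (ρ : Density P j G) (hρm : Measurable ρ) (hρ0 : ∀ W, 0 ≤ ρ W) (hρ : Integrable ρ (fieldMeasure P j G)) (hρinv : GaugeField.GaugeInvariant ρ)
    (hloc : ∀ W W' : GaugeField P j G, (∀ b' : PBond P j, blockOf b'.src ∈ 𝔅 → W b' = W' b') → ρ W = ρ W') :
    ((fieldMeasure P j G).withDensity fun U => ENNReal.ofReal (ρ U * {W : GaugeField P j G | ∀ c ∈ S, Small ℰ W c}.indicator (fun _ => (1 : ℝ)) U)).map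
        (fun U => (fun c => if c ∈ S then avgFun ℰ U c else axialAvg U c : GaugeField P (j + 1) G)) =
      ENNReal.ofReal (∫ U, ρ U * {W : GaugeField P j G | ∀ c ∈ S, Small ℰ W c}.indicator (fun _ => (1 : ℝ)) U ∂(fieldMeasure P j G)) • fieldMeasure P (j + 1) G := by
  haveI := HaarData.isProb (G := G)
  -- the guarded density `ρ' = ρ·1_{G_S}`
  have hρ'm : Measurable fun U : GaugeField P j G => ρ U * {W : GaugeField P j G | ∀ c ∈ S, Small ℰ W c}.indicator (fun _ => (1 : ℝ)) U :=
    hρm.mul (measurable_const.indicator (measurableSet_guardAll ℰ _))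
  have hρ'0 : ∀ W : GaugeField P j G, 0 ≤ ρ W * {W : GaugeField P j G | ∀ c ∈ S, Small ℰ W c}.indicator (fun _ => (1 : ℝ)) W :=
    fun W => mul_nonneg (hρ0 W) (Set.indicator_nonneg (fun _ _ => zero_le_one) W)
  have hρ' : Integrable (fun U : GaugeField P j G => ρ U * {W : GaugeField P j G | ∀ c ∈ S, Small ℰ W c}.indicator (fun _ => (1 : ℝ)) U) (fieldMeasure P j G) :=
    hρ.mul_bdd ((measurable_const.indicator (measurableSet_guardAll ℰ _)).aestronglyMeasurable) (c := 1)
      (Filter.Eventually.of_forall fun U => by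
        by_cases hU : U ∈ {W : GaugeField P j G | ∀ c ∈ S, Small ℰ W c}
        · rw [Set.indicator_of_mem hU]; simp
        · rw [Set.indicator_of_notMem hU]; simp)
  have hρ'inv := gaugeInvariant_mul_guardAll_indicator ℰ S hρinv
  have hBlk : S.image PBond.src ∪ S.image PBond.tgt ⊆ 𝔅 := fun x hx => by
    rcases Finset.mem_union.1 hx with h | h
    · obtain ⟨c, hc, rfl⟩ := Finset.mem_image.1 h; exact (hS c hc).1
    · obtain ⟨c, hc, rfl⟩ := Finset.mem_image.1 h; exact (hS c hc).2
  have hρ'loc : ∀ W W' : GaugeField P j G, (∀ b' : PBond P j, blockOf b'.src ∈ 𝔅 → W b' = W' b') →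
      ρ W * {W : GaugeField P j G | ∀ c ∈ S, Small ℰ W c}.indicator (fun _ => (1 : ℝ)) W =
        ρ W' * {W : GaugeField P j G | ∀ c ∈ S, Small ℰ W c}.indicator (fun _ => (1 : ℝ)) W' := fun W W' hWW' => by
    rw [hloc W W' hWW', guardAll_indicator_blockLocal ℰ hj S W W' fun b' hb' => hWW' b' (hBlk hb')]
  set ρ' : GaugeField P j G → ℝ := fun U => ρ U * {W : GaugeField P j G | ∀ c ∈ S, Small ℰ W c}.indicator (fun _ => (1 : ℝ)) U with hρ'def
  set μρ : Measure (GaugeField P j G) := (fieldMeasure P j G).withDensity fun U => ENNReal.ofReal (ρ' U) with hμρ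
  haveI hfin : IsFiniteMeasure μρ := by
    refine ⟨?_⟩
    rw [hμρ, withDensity_apply _ MeasurableSet.univ, Measure.restrict_univ]
    exact (lintegral_ofReal_le_lintegral_enorm ρ').trans_lt hρ'.2
  have hμinv : ∀ u : GaugeTransf P j G, μρ.map (GaugeField.gaugeAct u) = μρ := fun u => map_gaugeAct_withDensity_of_gaugeInvariant hρ'm hρ'inv u
  have hHm : Measurable fun U : GaugeField P j G => (fun c => if c ∈ S then avgFun ℰ U c else axialAvg U c : GaugeField P (j + 1) G) := measurable_hybrid ℰ hE S
  -- the image law and its invariance (part 38A)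
  set ν : Measure (GaugeField P (j + 1) G) := μρ.map fun U : GaugeField P j G => (fun c => if c ∈ S then avgFun ℰ U c else axialAvg U c : GaugeField P (j + 1) G) with hν
  have hνinv : ∀ v : GaugeTransf P (j + 1) G, ν.map (GaugeField.gaugeAct v) = ν := fun v => map_gaugeAct_map_hybrid ℰ hj hE S μρ hμinv v
  have hνfin : IsFiniteMeasure ν := Measure.isFiniteMeasure_map μρ _
  -- part 35's product form at the far set of `𝔅` (part 37B)
  haveI : DecidablePred fun b' : PBond P j => ∃ c' : PBond P (j + 1), (c'.src ∉ 𝔅 ∨ c'.tgt ∉ 𝔅) ∧ line c' (if c'.src ∉ 𝔅 then 0 else P.L - 1) = b' :=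
    Classical.decPred _
  have hprod := map_withDensity_hybrid_split_eq_prod ℰ hj hE S (fun c' : PBond P (j + 1) => c'.src ∉ 𝔅 ∨ c'.tgt ∉ 𝔅)
    (fun c' : PBond P (j + 1) => if c'.src ∉ 𝔅 then 0 else P.L - 1) (fun c' _ => canonical_tau_lt _ c') (blockSet_far_spec hj S 𝔅 hS) ρ' hρ'0 hρ' (localOff_of_blockLocal hj _ ρ' hρ'loc)
  have hprod' : ν.map (FibreSplit.splitEquiv (fun c' : PBond P (j + 1) => c'.src ∉ 𝔅 ∨ c'.tgt ∉ 𝔅) (P := P) (G := G)) =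
      (μρ.map (fun U : GaugeField P j G => (FibreSplit.splitEquiv (fun c' : PBond P (j + 1) => c'.src ∉ 𝔅 ∨ c'.tgt ∉ 𝔅) (P := P) (G := G)
        (fun c => if c ∈ S then avgFun ℰ U c else axialAvg U c)).1)).prod (Measure.pi fun _ => (HaarData.haar : Measure G)) := by
    rw [hν, Measure.map_map (FibreSplit.splitEquiv _ (P := P) (G := G)).measurable hHm]
    exact hprod
  -- §1
  have h := eq_mass_smul_of_invariant_of_prod_of_forest (fun c' : PBond P (j + 1) => c'.src ∉ 𝔅 ∨ c'.tgt ∉ 𝔅) ν hνfin hνinv _ hprod' b hbinj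
    (fun m => (not_canonicalFar_iff _ (b m)).2 (hbnear m)) (fun c hc => hbonto c ((not_canonicalFar_iff _ c).1 hc)) side hleaf
  have hνmass : ν Set.univ = ENNReal.ofReal (∫ U, ρ' U ∂(fieldMeasure P j G)) := by
    have h1 : ν Set.univ = μρ Set.univ := by
      rw [hν]
      exact (Measure.map_apply hHm MeasurableSet.univ).trans (by rw [Set.preimage_univ])
    rw [h1, hμρ, withDensity_apply _ MeasurableSet.univ, Measure.restrict_univ, ofReal_integral_eq_lintegral_ofReal hρ' (Filter.Eventually.of_forall hρ'0)]
  rw [hνmass] at h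
  exact h

end BlockSet

/-! ## §3 At the [B10] slot's averaging `avOfPrint N S₀ j` on `SU(N)` -/

section Slot

open Literature.MathematicalPhysics.QuantumFieldTheory.Balaban1985CMP102.Setting (Scales)
open Literature.MathematicalPhysics.QuantumFieldTheory.Balaban1983to89.ExpMeanLog (expMeanLogSU measurable_expMeanLogSU_E)
open Literature.MathematicalPhysics.QuantumFieldTheory.Balaban1983to89.Node00 (SU)

variable (N : ℕ) [NeZero N] {L : ℕ}

/-- ★★★ **AT THE SLOT: FOREST POLYMERS RELATIVE TO A BLOCK SET ARE INVISIBLE** (print's exp-mean-log averaging on `SU(N)`, every `N`, standing range): for `ρ ≥ 0` gauge invariant,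
measurable, integrable, reading only the blocks of `𝔅 ⊇ Blk(S)`, and the bonds with both end blocks in `𝔅` an acyclic family:
`((ρ·1_{G_S})·dU)∘(Ū^S)⁻¹ = (∫ ρ·1_{G_S} dU) • dV`. [cite: Balaban1985UV3, (2) p.256; Balaban1987RG1, (2.1) p.265 + (0.4) p.253 (bookkeeping)] -/
theorem map_withDensity_guard_hybrid_avOfPrint_eq_smul_of_blockSet_forest (S₀ : Scales L) {j : ℕ} (hj : j + 1 ≤ S₀.P.m + S₀.P.K) [DecidableEq (PBond S₀.P (j + 1))]
    (S : Finset (PBond S₀.P (j + 1))) (𝔅 : Finset (Site S₀.P (j + 1))) (hS : ∀ c ∈ S, c.src ∈ 𝔅 ∧ c.tgt ∈ 𝔅)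
    {n : ℕ} (b : Fin n → PBond S₀.P (j + 1)) (hbinj : Function.Injective b) (hbnear : ∀ m, (b m).src ∈ 𝔅 ∧ (b m).tgt ∈ 𝔅)
    (hbonto : ∀ c' : PBond S₀.P (j + 1), c'.src ∈ 𝔅 ∧ c'.tgt ∈ 𝔅 → ∃ m, b m = c')
    (side : Fin n → Bool)
    (hleaf : ∀ m m' : Fin n, m' < m →
      (if side m then (b m).src else (b m).tgt) ≠ (b m').src ∧ (if side m then (b m).src else (b m).tgt) ≠ (b m').tgt)
    (ρ : Density S₀.P j (SU N)) (hρm : Measurable ρ) (hρ0 : ∀ W, 0 ≤ ρ W) (hρ : Integrable ρ (fieldMeasure S₀.P j (SU N))) (hρinv : GaugeField.GaugeInvariant ρ)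
    (hloc : ∀ W W' : GaugeField S₀.P j (SU N), (∀ b' : PBond S₀.P j, blockOf b'.src ∈ 𝔅 → W b' = W' b') → ρ W = ρ W') :
    ((fieldMeasure S₀.P j (SU N)).withDensity fun U => ENNReal.ofReal
        (ρ U * {W : GaugeField S₀.P j (SU N) | ∀ c ∈ S, Small (expMeanLogSU : LoopAverage (SU N)) W c}.indicator (fun _ => (1 : ℝ)) U)).map
        (fun U => (fun c => if c ∈ S then avgFun (expMeanLogSU : LoopAverage (SU N)) U c else axialAvg U c : GaugeField S₀.P (j + 1) (SU N))) =
      ENNReal.ofReal (∫ U, ρ U * {W : GaugeField S₀.P j (SU N) | ∀ c ∈ S, Small (expMeanLogSU : LoopAverage (SU N)) W c}.indicator (fun _ => (1 : ℝ)) U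
          ∂(fieldMeasure S₀.P j (SU N))) • fieldMeasure S₀.P (j + 1) (SU N) :=
  map_withDensity_guard_hybrid_eq_smul_of_blockSet_forest (expMeanLogSU : LoopAverage (SU N)) hj measurable_expMeanLogSU_E S 𝔅 hS b hbinj hbnear hbonto side hleaf
    ρ hρm hρ0 hρ hρinv hloc

end Slot

end Summit.QuantumFields.YangMills.BalabanUVNodes.N08HaarCompatibilityGuardHybridForestBlockSet

end
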